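import Summits.CriticalPhenomena.Ising3DConformalLimit.Theorems.ArmDressingArmDressingGlueInvSystems
import Summits.CriticalPhenomena.Ising3DConformalLimit.Theorems.ArmDressingArmDressingGlueEdwardsSokal
import Literature.Probability.LatticeModels.CriticalUrsellFourSign
import Literature.Probability.LatticeModels.IsingPlusEdwardsSokalNPointBox
import Literature.Probability.LatticeModels.CriticalFKIsingConnectionLawsBox
import Literature.Probability.LatticeModels.CriticalCorrWellDefined
import HarnessLib

/-!
# Route `ArmDressing`, crux `ArmDressingGlue` (stmt-CriticalPhenomena-15700):
# stub `stub_secondMoment`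

The probabilistic core of the derivation of `CrossLawPositive` (skeleton v3 of the line
`registered` of the crux `ArmDressingGlue`): the SECOND-MOMENT INEQUALITY for the pair count between
two finite probe sets `X, Y ⊂ ℤ³` under the critical FK-Ising connection law `Pr`,

  `(Σ_{x∈X,y∈Y} ⟨σ_xσ_y⟩)² ≤ Pr[X ↔ Y] · Σ_{x,y,x',y'} (⟨σ_xσ_y⟩⟨σ_{x'}σ_{y'}⟩ + ⟨σ_xσ_{x'}⟩⟨σ_yσ_{y'}⟩
      + ⟨σ_xσ_{y'}⟩⟨σ_yσ_{x'}⟩)`,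

all correlators at `β_c(3)` with `+` boundary condition (`criticalCorr 3`).

Proof.
1. In the wired box `Λ_L` (`L` large, so that `X ∪ Y ⊆ Λ_L`), with `S_{xy}` the `EVEN` event of the
   marked pair `(x, y)` (which forces `x ↔ y`, `even_two_subset_pair`) and `E = {X ↔ Y} ⊇ S_{xy}`,
   Cauchy–Schwarz for the point masses of the (finitely supported) box measure gives
   `(Σ_{x,y} μ_L(S_{xy}))² ≤ μ_L(E) Σ_{x,y,x',y'} μ_L(S_{xy} ∩ S_{x'y'})`
   (`sq_sum_measureReal_le_mul_sum_inter`, a Chung–Erdős-type inequality: `N = N·1_E` for the pair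
   count `N = Σ 1_{S_{xy}}`).
2. `{x ↔ y} ∩ {x' ↔ y'} ⊆ EVEN(x, y, x', y')`: open connection is an equivalence relation, so every
   class among the four marked points has size `2` or `4` (`pair_inter_subset_even`,
   `even_ncard_fiber_four`).
3. `L → ∞` (`InvBook.tendsto_PrL`) and the infinite-volume Edwards–Sokal identity
   `Pr[EVEN(x₁,…,xₙ)] = ⟨σ_{x₁}⋯σ_{xₙ}⟩_{β_c}` (`criticalCorr_eq_Pr_even`: the landed
   `EdwardsSokalProof.stub_edwardsSokalIdentity` re-run without its unused injectivity hypothesis,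
   since coincidences `x = x'`, `y = y'` occur in the quadruple sum).
4. Lebowitz' inequality `U₄ ≤ 0` (`criticalUrsellFour_nonpos`, coincident points allowed) bounds the
   four-point function by the sum over the three pairings; `Pr ≥ 0` (`InvBook.Pr_mem_Icc`).

The disjointness hypothesis of the registered signature is not needed for the inequality.

References: J. L. Lebowitz, Comm. Math. Phys. 35 (1974), 87–92 (`U₄ ≤ 0`); K. L. Chung, P. Erdős,
Trans. Amer. Math. Soc. 72 (1952) (second-moment lower bound); G. Grimmett, *The Random-Cluster
Model* (2006), Thm. 1.16, §4.2, Thm. 4.19; F. Camia, Y. Feng, arXiv:2411.01467, §3.2.2 (planar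
template of the argument).
-/

noncomputable section

namespace Summit.CriticalPhenomena.Ising3DConformalLimit.Cruxes.ArmDressingGlue.CrossPos

open Summit.CriticalPhenomena.Ising3DConformalLimit.Cruxes.ArmDressingGlue.Vocab
open Summit.CriticalPhenomena.Ising3DConformalLimit.Theses
open scoped BigOperators Topology symmDiff
open Filter MeasureTheory Literature.Probability.LatticeModels Literature.Probability.Percolation
open Literature.Barriers.CriticalPhenomena

/-! ### §1 The infinite-volume Edwards–Sokal identity, coincident points allowed -/

/-- **Infinite-volume Edwards–Sokal identity at `β_c(3)`, arbitrary tuples**: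
`⟨∏ⱼ σ_{xⱼ}⟩⁺_{β_c} = Pr n ({xⱼ})ⱼ (EVEN n)` for EVERY `x : Fin n → ℤ³` (indices are counted with
multiplicity on both sides, so no injectivity is needed).  The proof is that of the landed
`EdwardsSokalProof.stub_edwardsSokalIdentity` (Grimmett 2006, Thm. 1.16 and §4.2 with `n` marked
points in finite volume; the boundary arms vanish in the limit because `m*(β_c) = 0`,
Aizenman–Duminil-Copin–Sidoravicius 2015), which never used its injectivity hypothesis.
[cite: Grimmett2006, Thm. 1.16 and §4.2 eqs. (4.12)–(4.13)] -/
theorem criticalCorr_eq_Pr_even (n : ℕ) (x : Fin n → Site 3) :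
    criticalCorr 3 n x = Pr n (fun j => {x j}) (EVEN n) := by
  -- adapted from `EdwardsSokalProof.stub_edwardsSokalIdentity` (same tree), injectivity dropped
  have hd : (3 : ℕ) ≤ 3 := le_rfl
  have hβ : 0 ≤ criticalBeta 3 := criticalBeta_nonneg 3
  -- the boundary arms of the marked points and their vanishing
  set arm : Fin n → (M : ℕ) → Set (BondConfig (BoxV 3 M)) := fun j M =>
    {ω | ∃ a y : BoxV 3 M, a.1 = x j ∧ y ∈ boxBoundary 3 M ∧ (openGraph ω).Reachable a y}
    with harm
  have harm0 : ∀ j, Tendsto (fun M : ℕ => (μ M).real (arm j M)) atTop (𝓝 0) := fun j =>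
    tendsto_rcMeasure_real_siteArm_criticalBeta_box hd (x j)
  have hsum0 : Tendsto (fun M : ℕ => ∑ j, (μ M).real (arm j M)) atTop (𝓝 0) := by
    have h := tendsto_finsetSum (Finset.univ : Finset (Fin n)) fun j _ => harm0 j
    rwa [Finset.sum_const_zero] at h
  -- the Ising side converges to the critical correlator
  have hIsing : Tendsto (fun L : ℕ =>
      isingExpect (zdGraph 3) (box 3 L) (criticalBeta 3) 0 .plus (spinMonomial x)) atTop
      (𝓝 (criticalCorr 3 n x)) :=
    criticalCorr_wellDefined_holds hd n x .plus (by simp)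
  -- all marked points eventually lie in the box
  obtain ⟨L₀, hL₀⟩ := exists_forall_subset_box (d := 3) (Finset.univ.image x)
  have hxL : ∀ L, L₀ ≤ L → ∀ j, x j ∈ box 3 L := fun L hL j =>
    hL₀ L hL (Finset.mem_image_of_mem x (Finset.mem_univ j))
  -- finite-volume Edwards–Sokal and the comparison of events, for `L ≥ L₀`
  have hcmp : ∀ L, L₀ ≤ L → |PrL n (fun j => {x j}) (EVEN n) (L + 1) -
      isingExpect (zdGraph 3) (box 3 L) (criticalBeta 3) 0 .plus (spinMonomial x)| ≤
        ∑ j, (μ (L + 1)).real (arm j (L + 1)) := by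
    intro L hL
    have hx1 : ∀ j, x j ∈ box 3 (L + 1) := fun j => box_mono 3 (Nat.le_succ L) (hxL L hL j)
    rw [isingExpect_plus_box_spinMonomial_eq_rcMeasure_real (d := 3) (by norm_num) hβ L x hx1]
    change |(μ (L + 1)).real _ - (μ (L + 1)).real _| ≤ _
    calc _ ≤ (μ (L + 1)).real (_ ∆ _) :=
          abs_measureReal_sub_le_measureReal_symmDiff (Set.toFinite _).measurableSet.nullMeasurableSet
            (Set.toFinite _).measurableSet.nullMeasurableSet
      _ ≤ (μ (L + 1)).real (⋃ j, arm j (L + 1)) :=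
          measureReal_mono (EdwardsSokalProof.symmDiff_evenLaw_evenOffBoundary_subset (L + 1) x hx1)
            (measure_ne_top _ _)
      _ ≤ ∑ j, (μ (L + 1)).real (arm j (L + 1)) := measureReal_iUnion_fintype_le _
  -- assemble: `PrL (L+1) → criticalCorr`, shift the index, identify the `limUnder`
  have h0 : Tendsto (fun L : ℕ => PrL n (fun j => {x j}) (EVEN n) (L + 1) -
      isingExpect (zdGraph 3) (box 3 L) (criticalBeta 3) 0 .plus (spinMonomial x)) atTop (𝓝 0) := by
    refine squeeze_zero_norm' ?_ (hsum0.comp (tendsto_add_atTop_nat 1))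
    filter_upwards [eventually_ge_atTop L₀] with L hL
    rw [Real.norm_eq_abs]
    exact hcmp L hL
  have h1 : Tendsto (fun L : ℕ => PrL n (fun j => {x j}) (EVEN n) (L + 1)) atTop
      (𝓝 (criticalCorr 3 n x)) := by
    have h := hIsing.add h0
    rw [add_zero] at h
    exact h.congr fun L => by ring
  have h2 : Tendsto (PrL n (fun j => {x j}) (EVEN n)) atTop (𝓝 (criticalCorr 3 n x)) :=
    (tendsto_add_atTop_iff_nat 1).1 h1
  exact (h2.limUnder_eq).symm

/-! ### §2 A Chung–Erdős-type inequality for finitely many events -/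

/-- **Second-moment (Chung–Erdős-type) inequality** for a finite measure carried by a finite type:
if the events `S i`, `i ∈ I`, all lie inside `E`, then
`(Σᵢ μ(Sᵢ))² ≤ μ(E) · Σᵢ Σⱼ μ(Sᵢ ∩ Sⱼ)` — Cauchy–Schwarz for the point masses applied to
`N = Σᵢ 1_{Sᵢ} = N · 1_E`: `(∫ N)² = (∫ N 1_E)² ≤ ∫ 1_E · ∫ N²`. [folklore] -/
theorem sq_sum_measureReal_le_mul_sum_inter {Ω ι : Type*} [Finite Ω] [MeasurableSpace Ω]
    [MeasurableSingletonClass Ω] (ν : Measure Ω) [IsFiniteMeasure ν] (I : Finset ι)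
    (S : ι → Set Ω) (E : Set Ω) (hS : ∀ i ∈ I, S i ⊆ E) :
    (∑ i ∈ I, ν.real (S i)) ^ 2 ≤ ν.real E * ∑ i ∈ I, ∑ i' ∈ I, ν.real (S i ∩ S i') := by
  classical
  cases nonempty_fintype Ω
  -- every real measure is a sum of point masses
  have hpt : ∀ A : Set Ω, ν.real A = ∑ ω, ν.real {ω} * A.indicator 1 ω := by
    intro A
    calc ν.real A = ν.real (↑(Finset.univ.filter (· ∈ A)) : Set Ω) := by
          congr 1; ext ω; simp
      _ = ∑ ω ∈ Finset.univ.filter (· ∈ A), ν.real {ω} := (sum_measureReal_singleton _).symm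
      _ = ∑ ω, if ω ∈ A then ν.real {ω} else 0 := Finset.sum_filter _ _
      _ = ∑ ω, ν.real {ω} * A.indicator 1 ω := Finset.sum_congr rfl fun ω _ => by
          by_cases h : ω ∈ A <;> simp [h]
  -- the pair count vanishes off `E`
  have hN : ∀ ω, ω ∉ E → ∑ i ∈ I, (S i).indicator (1 : Ω → ℝ) ω = 0 := fun ω hω =>
    Finset.sum_eq_zero fun i hi => Set.indicator_of_notMem (fun h => hω (hS i hi h)) _
  have e1 : ∑ i ∈ I, ν.real (S i) = ∑ ω, ν.real {ω} * ∑ i ∈ I, (S i).indicator 1 ω := by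
    rw [Finset.sum_congr rfl fun i _ => hpt (S i), Finset.sum_comm]
    simp_rw [Finset.mul_sum]
  have e2 : ∑ i ∈ I, ∑ i' ∈ I, ν.real (S i ∩ S i') =
      ∑ ω, ν.real {ω} * (∑ i ∈ I, (S i).indicator 1 ω) ^ 2 := by
    rw [Finset.sum_congr rfl fun i _ => Finset.sum_congr rfl fun i' _ => hpt (S i ∩ S i')]
    simp_rw [Set.inter_indicator_one, Pi.mul_apply, sq, Finset.sum_mul_sum, Finset.mul_sum]
    symm
    rw [Finset.sum_comm]
    exact Finset.sum_congr rfl fun i _ => Finset.sum_comm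
  rw [e1, e2, hpt E]
  refine Finset.sum_sq_le_sum_mul_sum_of_sq_le_mul Finset.univ
    (fun ω _ => mul_nonneg measureReal_nonneg (Set.indicator_nonneg (fun _ _ => zero_le_one) _))
    (fun ω _ => mul_nonneg measureReal_nonneg (sq_nonneg _)) fun ω _ => ?_
  by_cases hω : ω ∈ E
  · rw [Set.indicator_of_mem hω, Pi.one_apply, mul_one]
    exact le_of_eq (by ring)
  · rw [hN ω hω]
    simp

/-! ### §3 Classes among four labels, and the connection relation of marked points -/

/-- Four labels with `f 0 = f 1` and `f 2 = f 3` have all their fibres `{j | f j = f i}` of even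
size (`2` or `4`). [folklore] -/
theorem even_ncard_fiber_four {α : Type*} (f : Fin 4 → α) (h01 : f 0 = f 1) (h23 : f 2 = f 3)
    (i : Fin 4) : Even ({j : Fin 4 | f j = f i} : Set (Fin 4)).ncard := by
  by_cases h02 : f 0 = f 2
  · -- one class
    have hall : ∀ j, f j = f 0 := by
      intro j
      fin_cases j
      exacts [rfl, h01.symm, h02.symm, h23.symm.trans h02.symm]
    have hset : ({j : Fin 4 | f j = f i} : Set (Fin 4)) = Set.univ :=
      Set.eq_univ_of_forall fun j => (hall j).trans (hall i).symm
    rw [hset, Set.ncard_univ, Nat.card_eq_fintype_card, Fintype.card_fin]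
    exact ⟨2, rfl⟩
  · -- two classes `{0, 1}` and `{2, 3}`
    have h10 : f 1 = f 0 := h01.symm
    have h32 : f 3 = f 2 := h23.symm
    have h20 : f 2 ≠ f 0 := fun h => h02 h.symm
    have h30 : f 3 ≠ f 0 := fun h => h02 (h.symm.trans h32)
    have h12 : f 1 ≠ f 2 := fun h => h02 (h01.trans h)
    have hA : ∀ k, f k = f 0 → ({j : Fin 4 | f j = f k} : Set (Fin 4)) = {0, 1} := by
      intro k hk
      ext j
      simp only [Set.mem_setOf_eq, Set.mem_insert_iff, Set.mem_singleton_iff, hk]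
      fin_cases j
      · exact iff_of_true rfl (Or.inl rfl)
      · exact iff_of_true h10 (Or.inr rfl)
      · exact iff_of_false h20 (by decide)
      · exact iff_of_false h30 (by decide)
    have hB : ∀ k, f k = f 2 → ({j : Fin 4 | f j = f k} : Set (Fin 4)) = {2, 3} := by
      intro k hk
      ext j
      simp only [Set.mem_setOf_eq, Set.mem_insert_iff, Set.mem_singleton_iff, hk]
      fin_cases j
      · exact iff_of_false h02 (by decide)
      · exact iff_of_false h12 (by decide)
      · exact iff_of_true rfl (Or.inl rfl)
      · exact iff_of_true h32 (Or.inr rfl)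
    have hi : f i = f 0 ∨ f i = f 2 := by
      fin_cases i
      exacts [Or.inl rfl, Or.inl h10, Or.inr rfl, Or.inr h32]
    rcases hi with hi | hi
    · rw [hA i hi, Set.ncard_pair (by decide)]
      exact even_two
    · rw [hB i hi, Set.ncard_pair (by decide)]
      exact even_two

/-- For marked vertices `q i` of the box sitting at the lattice points `p i`, the route's relation
"some vertex at `p i` is joined to some vertex at `p j`" is open reachability of `q j` from `q i`.
[folklore] -/
theorem rel_iff_reachable {n L : ℕ} (ω : BondConfig (BoxV 3 L)) (p : Fin n → Site 3)
    (q : Fin n → BoxV 3 L) (hq : ∀ i, (q i).1 = p i) (i j : Fin n) :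
    (∃ u v : BoxV 3 L, u.1 ∈ ({p i} : Set (Site 3)) ∧ v.1 ∈ ({p j} : Set (Site 3)) ∧
        (openGraph ω).Reachable u v) ↔ (openGraph ω).Reachable (q i) (q j) := by
  constructor
  · rintro ⟨u, v, hu, hv, huv⟩
    rw [Set.mem_singleton_iff, ← hq] at hu hv
    have hu' : u = q i := Subtype.ext hu
    have hv' : v = q j := Subtype.ext hv
    subst hu' hv'
    exact huv
  · intro h
    exact ⟨q i, q j, by rw [Set.mem_singleton_iff, hq], by rw [Set.mem_singleton_iff, hq], h⟩

/-- For `x, y ∈ Λ_L`, on the `EVEN 2` event of the marked pair `(x, y)` the two points are joined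
(the class of `x` contains `x` itself, so being even it contains `y`). [folklore] -/
theorem even_two_subset_pair (L : ℕ) {x y : Site 3} (hx : x ∈ box 3 L) (hy : y ∈ box 3 L) :
    {ω : BondConfig (BoxV 3 L) | (fun i j => ∃ u v : BoxV 3 L,
        u.1 ∈ ({![x, y] i} : Set (Site 3)) ∧ v.1 ∈ ({![x, y] j} : Set (Site 3)) ∧
          (openGraph ω).Reachable u v) ∈ EVEN 2} ⊆
      {ω | ∃ u v : BoxV 3 L, u.1 ∈ ({x} : Set (Site 3)) ∧ v.1 ∈ ({y} : Set (Site 3)) ∧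
        (openGraph ω).Reachable u v} := by
  intro ω hω
  have hq : ∀ i, (![(⟨x, hx⟩ : BoxV 3 L), ⟨y, hy⟩] i).1 = ![x, y] i := by
    intro i
    fin_cases i <;> rfl
  have hrel := rel_iff_reachable ω ![x, y] ![⟨x, hx⟩, ⟨y, hy⟩] hq
  simp only [Set.mem_setOf_eq, EVEN] at hω
  simp_rw [hrel] at hω
  suffices h : (openGraph ω).Reachable (⟨x, hx⟩ : BoxV 3 L) ⟨y, hy⟩ from
    ⟨⟨x, hx⟩, ⟨y, hy⟩, rfl, rfl, h⟩
  by_contra hne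
  have hset : ({j : Fin 2 | (openGraph ω).Reachable (![(⟨x, hx⟩ : BoxV 3 L), ⟨y, hy⟩] 0)
      (![(⟨x, hx⟩ : BoxV 3 L), ⟨y, hy⟩] j)} : Set (Fin 2)) = {0} := by
    ext j
    fin_cases j
    · exact iff_of_true (SimpleGraph.Reachable.refl _) rfl
    · exact iff_of_false hne (by decide)
  have h0 := hω 0
  rw [hset, Set.ncard_singleton] at h0
  exact Nat.not_even_one h0

/-- **Two disjoint connections make an even pattern**: if `x ↔ y` and `x' ↔ y'` in `Λ_L`, every
class `{j | pⱼ ↔ pᵢ}` among the four marked points `p = (x, y, x', y')` has even size, because open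
connection is an equivalence relation (classes of size `2` or `4`; coincidences allowed). [folklore] -/
theorem pair_inter_subset_even (L : ℕ) (x y x' y' : Site 3) :
    ({ω : BondConfig (BoxV 3 L) | ∃ u v : BoxV 3 L, u.1 ∈ ({x} : Set (Site 3)) ∧
        v.1 ∈ ({y} : Set (Site 3)) ∧ (openGraph ω).Reachable u v} ∩
      {ω | ∃ u v : BoxV 3 L, u.1 ∈ ({x'} : Set (Site 3)) ∧ v.1 ∈ ({y'} : Set (Site 3)) ∧
        (openGraph ω).Reachable u v}) ⊆
      {ω | (fun i j => ∃ u v : BoxV 3 L, u.1 ∈ ({![x, y, x', y'] i} : Set (Site 3)) ∧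
        v.1 ∈ ({![x, y, x', y'] j} : Set (Site 3)) ∧ (openGraph ω).Reachable u v) ∈ EVEN 4} := by
  rintro ω ⟨⟨u, v, hu, hv, huv⟩, ⟨u', v', hu', hv', hu'v'⟩⟩
  rw [Set.mem_singleton_iff] at hu hv hu' hv'
  have hq : ∀ i, (![u, v, u', v'] i).1 = ![x, y, x', y'] i := by
    intro i
    fin_cases i
    exacts [hu, hv, hu', hv']
  simp only [Set.mem_setOf_eq, EVEN]
  intro i
  simp_rw [rel_iff_reachable ω ![x, y, x', y'] ![u, v, u', v'] hq]
  have key : ({j : Fin 4 | (openGraph ω).Reachable (![u, v, u', v'] i) (![u, v, u', v'] j)} :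
      Set (Fin 4)) = {j | (openGraph ω).connectedComponentMk (![u, v, u', v'] j) =
        (openGraph ω).connectedComponentMk (![u, v, u', v'] i)} := by
    ext j
    simp only [Set.mem_setOf_eq, SimpleGraph.ConnectedComponent.eq]
    exact ⟨SimpleGraph.Reachable.symm, SimpleGraph.Reachable.symm⟩
  rw [key]
  exact even_ncard_fiber_four (fun j => (openGraph ω).connectedComponentMk (![u, v, u', v'] j))
    (SimpleGraph.ConnectedComponent.sound huv) (SimpleGraph.ConnectedComponent.sound hu'v') i

/-! ### §4 The finite-volume inequality and the stub -/

/-- **Finite-volume second-moment inequality**: for `X, Y ⊆ Λ_L`,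
`(Σ_{x,y} μ_L[EVEN(x,y)])² ≤ μ_L[X ↔ Y] · Σ_{x,y,x',y'} μ_L[EVEN(x,y,x',y')]` (Cauchy–Schwarz for
the pair count, then `{x↔y} ∩ {x'↔y'} ⊆ EVEN(x,y,x',y')`). [folklore] -/
theorem finiteVolume_sq_sum_le (X Y : Finset (Site 3)) (L : ℕ) (hX : ∀ x ∈ X, x ∈ box 3 L)
    (hY : ∀ y ∈ Y, y ∈ box 3 L) :
    (∑ x ∈ X, ∑ y ∈ Y, PrL 2 (fun j => {![x, y] j}) (EVEN 2) L) ^ 2 ≤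
      PrL 2 ![(↑X : Set (Site 3)), ↑Y] {R | R 0 1} L *
        ∑ x ∈ X, ∑ y ∈ Y, ∑ x' ∈ X, ∑ y' ∈ Y,
          PrL 4 (fun j => {![x, y, x', y'] j}) (EVEN 4) L := by
  classical
  have hCS := sq_sum_measureReal_le_mul_sum_inter (μ L) (X ×ˢ Y)
    (fun p : Site 3 × Site 3 => {ω : BondConfig (BoxV 3 L) | (fun i j => ∃ u v : BoxV 3 L,
      u.1 ∈ ({![p.1, p.2] i} : Set (Site 3)) ∧ v.1 ∈ ({![p.1, p.2] j} : Set (Site 3)) ∧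
        (openGraph ω).Reachable u v) ∈ EVEN 2})
    {ω | ∃ u v : BoxV 3 L, u.1 ∈ (↑X : Set (Site 3)) ∧ v.1 ∈ (↑Y : Set (Site 3)) ∧
      (openGraph ω).Reachable u v} ?_
  · simp only [Finset.sum_product] at hCS
    refine hCS.trans (mul_le_mul_of_nonneg_left ?_ measureReal_nonneg)
    refine Finset.sum_le_sum fun x hx => Finset.sum_le_sum fun y hy =>
      Finset.sum_le_sum fun x' hx' => Finset.sum_le_sum fun y' hy' => ?_
    exact measureReal_mono ((Set.inter_subset_inter (even_two_subset_pair L (hX x hx) (hY y hy))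
      (even_two_subset_pair L (hX x' hx') (hY y' hy'))).trans (pair_inter_subset_even L x y x' y'))
      (measure_ne_top _ _)
  · rintro ⟨x, y⟩ hp
    rw [Finset.mem_product] at hp
    refine (even_two_subset_pair L (hX x hp.1) (hY y hp.2)).trans ?_
    rintro ω ⟨u, v, hu, hv, huv⟩
    rw [Set.mem_singleton_iff] at hu hv
    exact ⟨u, v, Finset.mem_coe.2 (hu ▸ hp.1), Finset.mem_coe.2 (hv ▸ hp.2), huv⟩

/-- **STUB `stub_secondMoment` — second-moment inequality for two finite probe sets**: for finite
`X, Y ⊂ ℤ³`,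
`(Σ_{x∈X,y∈Y} ⟨σ_xσ_y⟩)² ≤ Pr[X ↔ Y] · Σ_{x,y,x',y'} (⟨σ_xσ_y⟩⟨σ_{x'}σ_{y'}⟩ + ⟨σ_xσ_{x'}⟩⟨σ_yσ_{y'}⟩
  + ⟨σ_xσ_{y'}⟩⟨σ_yσ_{x'}⟩)` at `β_c(3)`:
pair count and Cauchy–Schwarz under the wired box measure `μ L` (`finiteVolume_sq_sum_le`), then
`L → ∞` (`InvBook.tendsto_PrL`), the infinite-volume Edwards–Sokal identity
(`criticalCorr_eq_Pr_even`) and Lebowitz' inequality `U₄ ≤ 0` (`criticalUrsellFour_nonpos`).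
The disjointness hypothesis is not used. [cite: Lebowitz1974, Theorem, eq. (2.5b)] -/
theorem stub_secondMoment :
    ∀ (X Y : Finset (Site 3)), Disjoint X Y →
      (∑ x ∈ X, ∑ y ∈ Y, criticalCorr 3 2 ![x, y]) ^ 2 ≤
        Pr 2 ![(↑X : Set (Site 3)), ↑Y] {R | R 0 1} *
          ∑ x ∈ X, ∑ y ∈ Y, ∑ x' ∈ X, ∑ y' ∈ Y,
            (criticalCorr 3 2 ![x, y] * criticalCorr 3 2 ![x', y'] +
              criticalCorr 3 2 ![x, x'] * criticalCorr 3 2 ![y, y'] +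
              criticalCorr 3 2 ![x, y'] * criticalCorr 3 2 ![y, x']) := by
  intro X Y _
  have hK : ∀ i, (![(↑X : Set (Site 3)), ↑Y] i).Finite ∨ (![(↑X : Set (Site 3)), ↑Y] i)ᶜ.Finite :=
    Fin.forall_fin_two.2 ⟨Or.inl X.finite_toSet, Or.inl Y.finite_toSet⟩
  -- Step A: the inequality with the four-point function, by `L → ∞` in `finiteVolume_sq_sum_le`
  have hA : (∑ x ∈ X, ∑ y ∈ Y, criticalCorr 3 2 ![x, y]) ^ 2 ≤
      Pr 2 ![(↑X : Set (Site 3)), ↑Y] {R | R 0 1} *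
        ∑ x ∈ X, ∑ y ∈ Y, ∑ x' ∈ X, ∑ y' ∈ Y, criticalCorr 3 4 ![x, y, x', y'] := by
    have hlim1 : Tendsto (fun L => (∑ x ∈ X, ∑ y ∈ Y, PrL 2 (fun j => {![x, y] j}) (EVEN 2) L) ^ 2)
        atTop (𝓝 ((∑ x ∈ X, ∑ y ∈ Y, criticalCorr 3 2 ![x, y]) ^ 2)) := by
      refine (tendsto_finsetSum _ fun x _ => tendsto_finsetSum _ fun y _ => ?_).pow 2
      rw [criticalCorr_eq_Pr_even 2 ![x, y]]
      exact InvBook.tendsto_PrL (fun i => Or.inl (Set.finite_singleton _)) _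
    have hlim2 : Tendsto (fun L => PrL 2 ![(↑X : Set (Site 3)), ↑Y] {R | R 0 1} L *
        ∑ x ∈ X, ∑ y ∈ Y, ∑ x' ∈ X, ∑ y' ∈ Y, PrL 4 (fun j => {![x, y, x', y'] j}) (EVEN 4) L)
        atTop (𝓝 (Pr 2 ![(↑X : Set (Site 3)), ↑Y] {R | R 0 1} *
          ∑ x ∈ X, ∑ y ∈ Y, ∑ x' ∈ X, ∑ y' ∈ Y, criticalCorr 3 4 ![x, y, x', y'])) := by
      refine (InvBook.tendsto_PrL hK _).mul (tendsto_finsetSum _ fun x _ =>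
        tendsto_finsetSum _ fun y _ => tendsto_finsetSum _ fun x' _ =>
          tendsto_finsetSum _ fun y' _ => ?_)
      rw [criticalCorr_eq_Pr_even 4 ![x, y, x', y']]
      exact InvBook.tendsto_PrL (fun i => Or.inl (Set.finite_singleton _)) _
    refine le_of_tendsto_of_tendsto hlim1 hlim2 ?_
    obtain ⟨L₀, hL₀⟩ := exists_forall_subset_box (d := 3) (X ∪ Y)
    filter_upwards [eventually_ge_atTop L₀] with L hL
    exact finiteVolume_sq_sum_le X Y L (fun x hx => hL₀ L hL (Finset.mem_union_left Y hx))
      (fun y hy => hL₀ L hL (Finset.mem_union_right X hy))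
  -- Step B: Lebowitz' inequality, summed, times `Pr ≥ 0`
  refine hA.trans (mul_le_mul_of_nonneg_left ?_ (InvBook.Pr_mem_Icc hK _).1)
  refine Finset.sum_le_sum fun x _ => Finset.sum_le_sum fun y _ => Finset.sum_le_sum fun x' _ =>
    Finset.sum_le_sum fun y' _ => ?_
  have h : criticalCorr 3 4 ![x, y, x', y'] -
      (criticalCorr 3 2 ![x, y] * criticalCorr 3 2 ![x', y'] +
        criticalCorr 3 2 ![x, x'] * criticalCorr 3 2 ![y, y'] +
        criticalCorr 3 2 ![x, y'] * criticalCorr 3 2 ![y, x']) ≤ 0 :=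
    criticalUrsellFour_nonpos le_rfl ![x, y, x', y']
  exact sub_nonpos.1 h

end Summit.CriticalPhenomena.Ising3DConformalLimit.Cruxes.ArmDressingGlue.CrossPos

end
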